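import Summits.RiemannHypothesis.RiemannHypothesis.Theorems.WeilFormatCDataO97FrontData
import Summits.RiemannHypothesis.RiemannHypothesis.Theorems.S2FormatCE0
import Literature.NumberTheory.LFunctions.YoshidaWindowGramTailMSSines
import Literature.NumberTheory.LFunctions.YoshidaWindowGramMiddleJBox
import Literature.NumberTheory.LFunctions.YoshidaWindowGramTailJFactoredScaled
import Literature.NumberTheory.LFunctions.YoshidaWindowGramTailMSFactored
import Literature.NumberTheory.LFunctions.YoshidaWindowGramTailJDiagTight
import Summits.RiemannHypothesis.RiemannHypothesis.Theorems.FormatCPsdBands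
import Summits.RiemannHypothesis.RiemannHypothesis.Theorems.WeilFormatCDiagShift
import HarnessLib

/-!
# Format C kernel rung `O97` (a = 9729/10000, column-band layout): the middle moment records are the ones computed from the light table (kernel certificates) and hence valid

Window `a = 9729/10000`; prime powers in the window: 2, 3, 2^2, 5; prime constant A = 1825/1000 (`WeilFormatC.primeCoeff_form_ge_cells_09729`); evaluator parameters S = 2^256, Kpi 130, Kser 150, kred 8, Kexp 45, J 120; full table modes < 193; light column table modes < 1027; units 2^-250 (Schur entries), 2^-124 (column digits, width 127), 2^-118 (tail-factor digits, width 121), 2^-64 (reciprocal weights), 2^-40 (tail base); order-J tail J = 4, θ = 1/2048, η = 1/10 | 4/1.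
Design row: sr-gb-rung-b odd λ-run (parity cell 11 L-side): a = 9729/10000, μ = 2^-81, odd 192/384/1024, MS tail; see HOME(A)/LADDER-LSIDES-FORMATC-A-g22.md and HOME(B)/NOTES-B-g19.md. Generated by sr-gb-rung-a prover A g22 with rh-explicit-weil-2 gen7's generator extended for the odd λ-run (--sector odd --mu-log2; HOME(A)/code-g22/gen7/gramgen7.py sha16 172ee47dc0b1c923) from `#eval` of the tree's `Encl` functions; every datum is re-verified by the kernel in the theorem files (`decide +kernel`). Helper data of the rh-explicit Weil-positivity programme (format C, K-CELL-2), RH-free. [cite: Yoshida1992HermitianForms, §5 (5.15)-(5.16) p. 301; §7 pp. 305–312]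
-/

set_option linter.dupNamespace false
set_option maxRecDepth 200000

namespace Summit.RiemannHypothesis.RiemannHypothesis.Theorems.WeilFormatCData.O97
open Literature.NumberTheory.LFunctions Literature.NumberTheory.LFunctions.Yoshida1992 Encl Literature.Analysis.ValidatedNumerics.NumericsMP

/-- kernel: the AA block of the odd moment record is the one computed from the light table. -/
theorem tMomO_AA : O97.momO.AA = (midMomO (2 ^ 256) O97.C O97.ctab 64 (O97CBOdd.vw.drop 192) 384 640 4).AA := by decide +kernel

/-- kernel: the AB block of the odd moment record is the one computed from the light table. -/
theorem tMomO_AB : O97.momO.AB = (midMomO (2 ^ 256) O97.C O97.ctab 64 (O97CBOdd.vw.drop 192) 384 640 4).AB := by decide +kernel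

/-- kernel: the BA block of the odd moment record is the one computed from the light table. -/
theorem tMomO_BA : O97.momO.BA = (midMomO (2 ^ 256) O97.C O97.ctab 64 (O97CBOdd.vw.drop 192) 384 640 4).BA := by decide +kernel

/-- kernel: the BB block of the odd moment record is the one computed from the light table. -/
theorem tMomO_BB : O97.momO.BB = (midMomO (2 ^ 256) O97.C O97.ctab 64 (O97CBOdd.vw.drop 192) 384 640 4).BB := by decide +kernel

/-- kernel: the remainder moment. -/
theorem tMomO_sm : O97.momO.sm = (midMomO (2 ^ 256) O97.C O97.ctab 64 (O97CBOdd.vw.drop 192) 384 640 4).sm := by decide +kernel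

end Summit.RiemannHypothesis.RiemannHypothesis.Theorems.WeilFormatCData.O97
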